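import Mathlib
import HarnessLib
import Summits.HubbardSuperconductivity.HubbardSuperconductivity.Theorems.KLProgrammeKLRegimeCountertermJacksonFrameDeriv
import Summits.HubbardSuperconductivity.HubbardSuperconductivity.Theorems.KLProgrammeKLRegimeCountertermMultiSlotSelfMap
import Summits.HubbardSuperconductivity.HubbardSuperconductivity.Theorems.KLProgrammeKLRegimeSplitBundleV13

/-!
# Route `KLProgramme` — child Counterterm of crux K3 at GEN 5 (`CountertermP2 klPredsV13 klWindowC`, Δ23 / (R-I-min)):
# THE SELF-MAP OF FRAMEOK'S TUBE UNDER THE SMOOTHED PICARD STEP — `frameOK_jackson_of_multiSlotFn`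
# (seat hubbard-kl-k3c3-p2; technique «fixed point on FrameOK's tube (contraction in the frame norm)»)

Gen 5 (plan g12 RULING-DRAFT 01:33:11Z (R1)–(R4)): the two-leg PIECES are functions (`klTwoLegPieceFn … K.eval i`, V13 slot
`TwoLegSizesMST = TwoLegSizesMSFn … K.eval`), frames stay `TrigPolyC4v`, and child 2 emits its iterate by the JACKSON mean of fixed degree:
`K′ := jacksonFrame d Φ_n(K)`, `Φ_n(K)(q) := −Σ_{i≤n} ℓ_i^{Fn}(K)(q)`.  This file is `…CountertermMultiSlotSelfMap` (`frameOK_of_multiSlot′`)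
re-proved for function pieces with the smoothing in place of polynomial closure:

* §1 symmetric-frame algebra (`isSymmetricFrame_zero/_add/_neg/_finset_sum`, continuity from `ContDiff ℝ 4 (onM ·)`);
* §2 the aggregated slot FUNCTIONS `msPieceFn lp n N m` (scale-`m` part + the slot-`m` fine parts of the coarser pieces), the re-slotting identity
  `sum_multiSlotFn_eq_sum_msPieceFn`, their symmetry / `C⁴` / slot-allowance bound `norm_iteratedFDeriv_msPieceFn_le'` (sharp room
  `S_j + S′_j|U| + (Σ_{i≤n} msBar i)·Gfr_j ≤ Gfr_j`);
* §3 **`frameOK_jackson_of_multiSlotFn'`**: from (E3a-MS-Fn) at the pieces `i ≤ n ≤ nScales β`, the sharp room and the three small allowance sums on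
  the window: `FrameOK R U (nScales β) μ (jacksonFrame d Φ_n(K))` for EVERY degree `d` — the FrameOK (ii) pieces are `jacksonFrame d (msPieceFn … m)`,
  whose sizes are those of `msPieceFn … m` by (J2) `norm_iteratedFDeriv_eval_jacksonFrame_le` (CONSTANT ONE: `Gfr`, `msBar`, `klMsKappa`,
  `twoLegBar` frozen), and the sum identity is (J1) `eval_jacksonFrame` + linearity `jsmooth_finset_sum`; then p2's `frameOK_of_pieces`.

Proofs only; nothing is asserted about the Hubbard model.
-/

noncomputable section

namespace Summit.HubbardSuperconductivity.HubbardSuperconductivity.Theorems.KLRegimeSplit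

set_option linter.dupNamespace false -- summit = problem name (single-conjunct summit), D-0017

open Real Finset
open Literature.MathematicalPhysics.QuantumLattice Literature.Probability.LatticeModels
open Summit.HubbardSuperconductivity.HubbardSuperconductivity.Theorems.KLProgrammeLegKernels

/-! ## §1 Symmetric-frame algebra -/

/-- The zero function is a symmetric frame. -/
theorem isSymmetricFrame_zero : IsSymmetricFrame (fun _ : Fin 2 → ℝ => (0 : ℝ)) :=
  ⟨fun _ _ => rfl, fun _ => rfl, fun _ => rfl⟩

/-- Sums of symmetric frames are symmetric. -/
theorem IsSymmetricFrame.add' {F G : FrameFn} (hF : IsSymmetricFrame F) (hG : IsSymmetricFrame G) :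
    IsSymmetricFrame (fun p => F p + G p) :=
  ⟨fun p z => by show F _ + G _ = F p + G p; rw [hF.1 p z, hG.1 p z],
    fun p => by show F _ + G _ = F p + G p; rw [hF.2.1 p, hG.2.1 p],
    fun p => by show F _ + G _ = F p + G p; rw [hF.2.2 p, hG.2.2 p]⟩

/-- Negatives of symmetric frames are symmetric. -/
theorem IsSymmetricFrame.neg' {F : FrameFn} (hF : IsSymmetricFrame F) : IsSymmetricFrame (fun p => -F p) :=
  ⟨fun p z => by show -F _ = -F p; rw [hF.1 p z], fun p => by show -F _ = -F p; rw [hF.2.1 p],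
    fun p => by show -F _ = -F p; rw [hF.2.2 p]⟩

/-- Finite sums of symmetric frames are symmetric. -/
theorem isSymmetricFrame_finset_sum {ι : Type*} (s : Finset ι) {F : ι → FrameFn} (hF : ∀ i ∈ s, IsSymmetricFrame (F i)) :
    IsSymmetricFrame (fun p => ∑ i ∈ s, F i p) := by
  classical
  induction s using Finset.induction_on with
  | empty => simpa using isSymmetricFrame_zero
  | insert a s ha ih =>
    have h := (hF a (mem_insert_self a s)).add' (ih fun i hi => hF i (mem_insert_of_mem hi))
    simpa [sum_insert ha] using h

/-- An `if` between a symmetric frame and zero is symmetric. -/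
theorem isSymmetricFrame_ite (c : Prop) [Decidable c] {F : FrameFn} (hF : IsSymmetricFrame F) :
    IsSymmetricFrame (if c then F else fun _ => 0) := by
  split_ifs
  · exact hF
  · exact isSymmetricFrame_zero

/-- A function on `Fin 2 → ℝ` whose Euclidean reading `onM` is `Cⁿ` is continuous. -/
theorem continuous_of_contDiff_onM {F : FrameFn} {N : WithTop ℕ∞} (h : ContDiff ℝ N (onM F)) : Continuous F := by
  have hK : F = fun p : Fin 2 → ℝ => onM F (WithLp.toLp 2 p) := by funext p; simp [onM]
  rw [hK]
  exact h.continuous.comp (PiLp.continuous_toLp 2 _)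

/-! ## §2 The aggregated slot functions of `−Σ_{i≤n} ℓ_i^{Fn}(K)` -/

/-- **The slot-`m` FUNCTION of the wholesale counterterm iterate at level `n`**, from multi-slot decompositions `lp i : ℕ → FrameFn` of the
pieces `i ≤ n`: the scale-`m` part `lp m m` (if `m ≤ n`) plus the slot-`m` fine parts `lp i m` of the coarser pieces `i < m ≤ N`. -/
def msPieceFn (lp : ℕ → ℕ → FrameFn) (n N m : ℕ) : FrameFn :=
  fun q => ∑ i ∈ range (n + 1), (if m ∈ insert i (Ioc i N) then lp i m else fun _ => 0) q

/-- Evaluation of the aggregated slot function. -/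
theorem msPieceFn_apply (lp : ℕ → ℕ → FrameFn) (n N m : ℕ) (q : Fin 2 → ℝ) :
    msPieceFn lp n N m q = ∑ i ∈ range (n + 1), if m ∈ insert i (Ioc i N) then lp i m q else 0 := by
  unfold msPieceFn
  refine sum_congr rfl fun i _ => ?_
  split_ifs <;> rfl

/-- **Re-slotting identity** (function version of `sum_multiSlot_eq_sum_msPiece`). -/
theorem sum_multiSlotFn_eq_sum_msPieceFn (lp : ℕ → ℕ → FrameFn) {n N : ℕ} (hn : n ≤ N) (p : Fin 2 → ℝ) :
    ∑ i ∈ range (n + 1), (lp i i p + ∑ m ∈ Ioc i N, lp i m p) = ∑ m ∈ range (N + 1), msPieceFn lp n N m p := by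
  simp_rw [msPieceFn_apply]
  rw [sum_comm]
  refine sum_congr rfl fun i hi => ?_
  have hiN : i ≤ N := (Nat.lt_succ_iff.mp (mem_range.mp hi)).trans hn
  have hsub : insert i (Ioc i N) ⊆ range (N + 1) := by
    intro m hm
    rcases mem_insert.mp hm with rfl | hm
    · exact mem_range.mpr (Nat.lt_succ_of_le hiN)
    · exact mem_range.mpr (Nat.lt_succ_of_le (mem_Ioc.mp hm).2)
  rw [← sum_filter, filter_mem_eq_inter, (inter_eq_right.mpr hsub), sum_insert]
  exact fun h => (lt_irrefl i) (mem_Ioc.mp h).1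

/-- The aggregated slot functions are symmetric frames when the slot parts are. -/
theorem isSymmetricFrame_msPieceFn {lp : ℕ → ℕ → FrameFn} (hlp : ∀ i m, IsSymmetricFrame (lp i m)) (n N m : ℕ) :
    IsSymmetricFrame (msPieceFn lp n N m) := by
  unfold msPieceFn
  exact isSymmetricFrame_finset_sum _ fun i _ => isSymmetricFrame_ite _ (hlp i m)

/-- The aggregated slot functions are `C⁴` (Euclidean reading) when the slot parts are. -/
theorem contDiff_onM_msPieceFn {lp : ℕ → ℕ → FrameFn} {N' : WithTop ℕ∞} (hlp : ∀ i m, ContDiff ℝ N' (onM (lp i m))) (n N m : ℕ) :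
    ContDiff ℝ N' (onM (msPieceFn lp n N m)) := by
  have hfun : onM (msPieceFn lp n N m) =
      fun x => ∑ i ∈ range (n + 1), onM (if m ∈ insert i (Ioc i N) then lp i m else fun _ => 0) x := by
    funext x; simp [onM, msPieceFn]
  rw [hfun]
  refine ContDiff.sum fun i _ => ?_
  split_ifs
  · exact hlp i m
  · exact contDiff_const

/-- **Slot-`m` bound of the aggregated slot function, sharp room** (function version of `norm_iteratedFDeriv_msPiece_le'`). -/
theorem norm_iteratedFDeriv_msPieceFn_le' {G : GeoConsts} {Q : EngConsts} {R : RenConsts} (hG : G.WF) (hQ : Q.WF)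
    (hR : ∀ j, 0 ≤ R.Gfr j) {U : ℝ} {lp : ℕ → ℕ → FrameFn} (hlps : ∀ i m, ContDiff ℝ 4 (onM (lp i m))) {n N m j : ℕ} (hj : j ≤ 4)
    (hdiag : m ≤ n → ∀ q : Momentum, ‖iteratedFDeriv ℝ j (onM (lp m m)) q‖ ≤ twoLegBar G Q U j m)
    (hfine : ∀ i ≤ n, m ∈ Ioc i N → ∀ q : Momentum,
      ‖iteratedFDeriv ℝ j (onM (lp i m)) q‖ ≤ msBar G Q U i * (R.Gfr j * uPow j U * (4 : ℝ) ^ (((j : ℤ) - 2) * m)))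
    (hroom : G.S j + Q.S' j * |U| + (∑ i ∈ range (n + 1), msBar G Q U i) * R.Gfr j ≤ R.Gfr j) (q : Momentum) :
    ‖iteratedFDeriv ℝ j (onM (msPieceFn lp n N m)) q‖ ≤ R.Gfr j * uPow j U * (4 : ℝ) ^ (((j : ℤ) - 2) * m) := by
  set A : ℝ := R.Gfr j * uPow j U * (4 : ℝ) ^ (((j : ℤ) - 2) * m) with hA_def
  set W : ℝ := uPow j U * (4 : ℝ) ^ (((j : ℤ) - 2) * m) with hW_def
  have hW : 0 ≤ W := mul_nonneg (uPow_nonneg j U) (zpow_nonneg (by norm_num) _)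
  have hA : 0 ≤ A := mul_nonneg (mul_nonneg (hR j) (uPow_nonneg j U)) (zpow_nonneg (by norm_num) _)
  have hAW : A = R.Gfr j * W := by rw [hA_def, hW_def]; ring
  have hms : ∀ i, 0 ≤ msBar G Q U i := fun i => msBar_nonneg hG hQ U i
  have hfun : onM (msPieceFn lp n N m) =
      fun x => ∑ i ∈ range (n + 1), onM (if m ∈ insert i (Ioc i N) then lp i m else fun _ => 0) x := by
    funext x; simp [onM, msPieceFn]
  have hterm_smooth : ∀ i, ContDiff ℝ 4 (onM (if m ∈ insert i (Ioc i N) then lp i m else fun _ => 0)) := by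
    intro i; split_ifs
    · exact hlps i m
    · exact contDiff_const
  rw [hfun, iteratedFDeriv_fun_sum_apply fun i _ =>
    ((hterm_smooth i).of_le (by exact_mod_cast hj)).contDiffAt]
  refine (norm_sum_le _ _).trans ?_
  have hterm : ∀ i ∈ range (n + 1),
      ‖iteratedFDeriv ℝ j (onM (if m ∈ insert i (Ioc i N) then lp i m else fun _ => 0)) q‖ ≤
        (if i = m then twoLegBar G Q U j m else 0) + msBar G Q U i * A := by
    intro i hi
    have hin : i ≤ n := Nat.lt_succ_iff.mp (mem_range.mp hi)
    by_cases hc : m ∈ insert i (Ioc i N)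
    · rw [if_pos hc]
      rcases mem_insert.mp hc with hmi | hIoc
      · subst hmi
        rw [if_pos rfl]
        have := hdiag hin q
        nlinarith [hms m, hA]
      · have hne : i ≠ m := fun h => by subst h; exact (lt_irrefl i) (mem_Ioc.mp hIoc).1
        rw [if_neg hne, zero_add]
        exact hfine i hin hIoc q
    · rw [if_neg hc]
      have hz : onM (fun _ : Fin 2 → ℝ => (0 : ℝ)) = fun _ => 0 := by funext x; simp [onM]
      rw [hz, iteratedFDeriv_fun_zero]
      simp only [Pi.zero_apply, norm_zero]
      have h1 : 0 ≤ (if i = m then twoLegBar G Q U j m else 0) := by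
        split_ifs
        · exact twoLegBar_nonneg' hG hQ U j m
        · exact le_rfl
      nlinarith [hms i, hA]
  refine (sum_le_sum hterm).trans ?_
  rw [sum_add_distrib, ← sum_mul]
  have hdiagsum : ∑ i ∈ range (n + 1), (if i = m then twoLegBar G Q U j m else 0) ≤ (G.S j + Q.S' j * |U|) * W := by
    rw [sum_ite_eq' (range (n + 1)) m]
    have htlb : twoLegBar G Q U j m = (G.S j + Q.S' j * |U|) * W := by rw [hW_def]; unfold twoLegBar; ring
    split_ifs
    · exact htlb.le
    · have hS : 0 ≤ G.S j := hG.2.2.2.2.2.2.2.2.2.2.2.2.2.2.2.2.2.1 j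
      have hS' : 0 ≤ Q.S' j := hQ.2.2.2.2.1 j
      positivity
  have hroomW : ((G.S j + Q.S' j * |U|) + (∑ i ∈ range (n + 1), msBar G Q U i) * R.Gfr j) * W ≤ R.Gfr j * W :=
    mul_le_mul_of_nonneg_right hroom hW
  have hsplit : (G.S j + Q.S' j * |U|) * W + (∑ i ∈ range (n + 1), msBar G Q U i) * A =
      ((G.S j + Q.S' j * |U|) + (∑ i ∈ range (n + 1), msBar G Q U i) * R.Gfr j) * W := by rw [hAW]; ring
  rw [hAW]
  linarith

/-! ## §3 The self-map under the smoothed step -/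

section Model

variable {L M : ℕ} [NeZero L] [NeZero M]

/-- **SELF-MAP OF FRAMEOK'S TUBE UNDER THE SMOOTHED PICARD STEP (sharp room).**  If the function pieces `ℓ_i^{Fn}(K)`, `i ≤ n ≤ nScales β`,
satisfy (E3a-MS-Fn) (`TwoLegSizesMSFn … K.eval i`), the package gives the sharp room `S_j + S′_j|U| + (Σ_{i≤n} msBar i)·Gfr_j ≤ Gfr_j`
(`j ≤ 4`) and the slot allowances of orders `≤ 2` sum small on the window, then for EVERY degree `d` the smoothed wholesale iterate
`jacksonFrame d (−Σ_{i≤n} ℓ_i^{Fn}(K))` is an ADMISSIBLE frame: `FrameOK R U (nScales β) μ (…)`. -/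
theorem frameOK_jackson_of_multiSlotFn' {G : GeoConsts} {Q : EngConsts} {R : RenConsts} (hG : G.WF) (hQ : Q.WF)
    (hR : ∀ j, 0 ≤ R.Gfr j) {β U μ : ℝ} {K : TrigPolyC4v} {n : ℕ} (hn : n ≤ nScales β) (hμ : μ ∈ Set.Icc (-1.05 : ℝ) (-0.15))
    (hMS : ∀ i ≤ n, TwoLegSizesMSFn L M G Q R β U μ K.eval i)
    (hroom : ∀ j ≤ 4, G.S j + Q.S' j * |U| + (∑ i ∈ range (n + 1), msBar G Q U i) * R.Gfr j ≤ R.Gfr j)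
    (h0 : ∑ m ∈ range (nScales β + 1), R.Gfr 0 * uPow 0 U * (4 : ℝ) ^ (((0 : ℤ) - 2) * m) ≤ 3 / 80)
    (h1 : ∑ m ∈ range (nScales β + 1), R.Gfr 1 * uPow 1 U * (4 : ℝ) ^ (((1 : ℤ) - 2) * m) ≤ 1 / 2000)
    (h2 : ∑ m ∈ range (nScales β + 1), ∑ j ∈ range 3, R.Gfr j * uPow j U * (4 : ℝ) ^ (((j : ℤ) - 2) * m) ≤ 1 / 100) (d : ℕ) :
    FrameOK R U (nScales β) μ
      (jacksonFrame d fun q => -∑ i ∈ range (n + 1), klTwoLegPieceFn L M β U μ K.eval i q) := by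
  classical
  -- choose the multi-slot decompositions of the pieces `i ≤ n` (zero beyond `n`)
  have hch : ∀ i, ∃ lp : ℕ → FrameFn, (∀ m, IsSymmetricFrame (lp m) ∧ ContDiff ℝ 4 (onM (lp m))) ∧ (i ≤ n →
      (∀ p : Fin 2 → ℝ,
          klTwoLegPieceFn L M β U μ K.eval i p = lp i p + ∑ m ∈ Ioc i (nScales β), lp m p) ∧
      (∀ j ≤ 4, ∀ q : Momentum, ‖iteratedFDeriv ℝ j (onM (lp i)) q‖ ≤ twoLegBar G Q U j i) ∧
      (∀ m ∈ Ioc i (nScales β), ∀ j ≤ 4, ∀ q : Momentum,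
          ‖iteratedFDeriv ℝ j (onM (lp m)) q‖ ≤ msBar G Q U i * (R.Gfr j * uPow j U * (4 : ℝ) ^ (((j : ℤ) - 2) * m)))) := by
    intro i
    by_cases hi : i ≤ n
    · obtain ⟨lp, hdec, hsym, hd, hf⟩ := hMS i hi
      exact ⟨lp, hsym, fun _ => ⟨hdec, hd, hf⟩⟩
    · refine ⟨fun _ _ => 0, fun _ => ⟨isSymmetricFrame_zero, ?_⟩, fun h => absurd h hi⟩
      have hz : onM (fun _ : Fin 2 → ℝ => (0 : ℝ)) = fun _ => 0 := by funext x; simp [onM]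
      rw [hz]; exact contDiff_const
  choose lp hreg hlp using hch
  set N := nScales β with hN
  -- the symbol and its slot decomposition
  set Φ : FrameFn := fun q => -∑ i ∈ range (n + 1), klTwoLegPieceFn L M β U μ K.eval i q with hΦ
  have hΦeq : ∀ q, Φ q = -∑ m ∈ range (N + 1), msPieceFn lp n N m q := by
    intro q
    simp only [hΦ]
    rw [← sum_multiSlotFn_eq_sum_msPieceFn lp hn q]
    congr 1
    exact sum_congr rfl fun i hi => (hlp i (Nat.lt_succ_iff.mp (mem_range.mp hi))).1 q
  have hsymP : ∀ m, IsSymmetricFrame (msPieceFn lp n N m) := fun m =>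
    isSymmetricFrame_msPieceFn (fun i m => (hreg i m).1) n N m
  have hsmP : ∀ m, ContDiff ℝ 4 (onM (msPieceFn lp n N m)) := fun m =>
    contDiff_onM_msPieceFn (fun i m => (hreg i m).2) n N m
  have hcP : ∀ m, Continuous (msPieceFn lp n N m) := fun m => continuous_of_contDiff_onM (hsmP m)
  have hΦfun : Φ = fun q => -∑ m ∈ range (N + 1), msPieceFn lp n N m q := funext hΦeq
  have hsymΦ : IsSymmetricFrame Φ := by
    rw [hΦfun]; exact (isSymmetricFrame_finset_sum _ fun m _ => hsymP m).neg'
  have hcΦ : Continuous Φ := by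
    rw [hΦfun]; exact (continuous_finsetSum _ fun m _ => hcP m).neg
  -- the sum identity of FrameOK (ii): `E = −Σ_m 𝒥(msPieceFn m)`
  have hsumE : ∀ p : Fin 2 → ℝ, (jacksonFrame d Φ).eval p =
      ∑ m ∈ range (N + 1), (fsub 0 (jacksonFrame d (msPieceFn lp n N m))).eval p := by
    intro p
    rw [eval_jacksonFrame hcΦ hsymΦ.1 hsymΦ.2.1 hsymΦ.2.2, hΦfun, jsmooth_neg,
      jsmooth_finset_sum d _ _ (fun m _ => hcP m), ← sum_neg_distrib]
    refine sum_congr rfl fun m _ => ?_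
    rw [eval_fsub, TrigPolyC4v.eval_zero, zero_sub, eval_jacksonFrame (hcP m) (hsymP m).1 (hsymP m).2.1 (hsymP m).2.2]
  refine frameOK_of_pieces hR hμ (Kp := fun m => jacksonFrame d (msPieceFn lp n N m)) hsumE ?_ h0 h1 h2
  -- the slot bounds pass through the smoothing with constant one (J2)
  intro m _ j hj q
  have hB : ∀ i ≤ 4, ∀ x : EuclideanSpace ℝ (Fin 2),
      ‖iteratedFDeriv ℝ i (fun x : EuclideanSpace ℝ (Fin 2) => msPieceFn lp n N m (WithLp.ofLp x)) x‖ ≤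
        R.Gfr i * uPow i U * (4 : ℝ) ^ (((i : ℤ) - 2) * m) := by
    intro i hi x
    exact norm_iteratedFDeriv_msPieceFn_le' hG hQ hR (fun i m => (hreg i m).2) hi
      (fun hmn q => (hlp m hmn).2.1 i hi q) (fun i' hi' hIoc q => (hlp i' hi').2.2 m hIoc i hi q) (hroom i hi) x
  exact (norm_iteratedFDeriv_eval_jacksonFrame_le d (hcP m) (hsymP m).1 (hsymP m).2.1 (hsymP m).2.2 (m := 4)
    (hsmP m) hB).2 j hj q

end Model

end Summit.HubbardSuperconductivity.HubbardSuperconductivity.Theorems.KLRegimeSplit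

end
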